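import Literature.NumberTheory.Automorphic.Liu2021.Prop46NonemptyOfCasselmanUnits
import Literature.NumberTheory.ComplexMultiplication.ReflexTypeNormDescent
import Literature.NumberTheory.GaloisRepresentations.HeckeCharacterDictionary
import Literature.NumberTheory.GaloisRepresentations.HeckeCharacterFiniteIdeleValuesProofs
import Literature.NumberTheory.GaloisRepresentations.HeckeCharacterAutConj
import Literature.AlgebraicGeometry.Motives.ZarhinHodgeGroupAutC
import Mathlib.NumberTheory.NumberField.ClassNumber
import HarnessLib

/-!
# [Liu 2021] Proposition 4.6 (1) from Casselman's theorem — the uniformiser clause of (19.10b) discharged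

Sequel of `Liu2021/Prop46NonemptyOfCasselmanUnits` (theorems only; no definition, no named fact).  The one displayed
hypothesis on `μ` left there is the uniformiser half of the ideal clause «`χ(x)𝔞 = f(x)𝔞`» of [Shimura1998] (19.10b) for
`χ = μ^{alg}`, `𝔞 = 𝔬_{M_μ}`: at every finite place `v` of `F`, `μ^{alg}(ϖ_v) = π_v ∈ 𝔬_{M_μ}` and `(π_v)` is the reflex type
norm of `𝔭_v` (the tree's `IsReflexTypeNorm`, read in any number field `L` normal over `ℚ` through which `F ⊆ ℂ` factors).
THIS FILE proves it — the SHIMURA–TANIYAMA FACTORISATION of the values of the algebraic Hecke character `μ^{alg}` of CM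
∞-type `Φ_μ` ([Weil1956] §1: the ideal generated by a value of a character of type `(A₀)` is given by its type;
[Shimura1998] (19.10b); [NeukirchANT1999] VII (6.13) for the decomposition of principal ideles):

* §1 bookkeeping: `h`-th roots of ideals in a Dedekind domain, powers of the reflex type norm, local units of valuation
  one, torsion values of a Hecke character on local units.
* §2 `image_comp_reflexTypeOn_valuedIn` — TRANSFER: for `L/ℚ` normal receiving `M` through `j` and `F` through `σL`, the
  reflex type `Ψ_j = reflexTypeOn (valuedIn ιL Θ) j σL ⊆ Hom(F, L)` read in `ℂ` through `ιL` IS the reflex type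
  `reflexTypeOn Θ (ιL ∘ j) (ιL ∘ σL) ⊆ Hom(F, ℂ)`.
* §3 `exists_pow_valueAtUniformizer_mul_eq_prod` — for an algebraic Hecke character `χ` of a totally complex field with
  ∞-type `typeOfExponent n` and `𝔭_v^h = (β)`: `χ(ϖ_v)^h · ζ = ∏_φ φ(β)^{n_φ}` with `ζ` a torsion element — a product of values
  of `χ` on local ideles of valuation one (Neukirch's decomposition `map_principalIdele_eq` of the principal idele `β`).
* §4 **`exists_integer_valueAtUniformizer_isReflexTypeNorm`** — the uniformiser clause for `μ^{alg}` at `(M_μ, Ψ̃_μ)`, and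
  **`nonempty_cmDatum_of_casselman'`** — [Liu2021] Prop. 4.6 (1), first clause «`𝒜(μ)` is nonempty», from Casselman's
  theorem with NO displayed hypothesis on `μ` left.

## References
* [Liu2021] Y. Liu, Camb. J. Math. 9 (2021) = arXiv:2102.11518 — §4.1 l. 1928, Def. 4.5, Prop. 4.6 (1) (l. 1969; proof
  ll. 1975–1984).
* [Shimura1998] G. Shimura, *Abelian Varieties with Complex Multiplication and Modular Functions* (1998), §8.3 Prop. 28–29,
  §19.7 (19.7a), Prop. 19.10 (19.10b), §21.4 Thm. 21.4.
* [Weil1956] A. Weil, *On a certain type of characters of the idèle-class group of an algebraic number-field* (1956), §1.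
* [NeukirchANT1999] J. Neukirch, *Algebraic Number Theory* (1999), Ch. VII §6 Prop. (6.13).
* [TateThesis1967] J. Tate, in Cassels–Fröhlich (1967), §2.3.
-/

set_option autoImplicit false

noncomputable section

open scoped NumberField ComplexConjugate Pointwise nonZeroDivisors
open NumberField IsDedekindDomain
open Literature.AlgebraicGeometry.Motives
open Literature.NumberTheory.ComplexMultiplication
open Literature.NumberTheory.GaloisRepresentations

namespace Literature.NumberTheory.Automorphic.Liu2021.Def45

/-! ## §1 Bookkeeping -/

section Bookkeeping

/-- **`h`-th roots of ideals in a Dedekind domain**: `I ^ h = J ^ h`, `h ≠ 0` ⟹ `I = J` (unique factorisation of ideals; the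
descent step of [Shimura1998] §8.3 Prop. 29). [cite: Shimura1998, §8.3 Prop. 29] -/
theorem ideal_eq_of_pow_eq_pow {R : Type*} [CommRing R] [IsDedekindDomain R] {I J : Ideal R} {h : ℕ} (hh : h ≠ 0)
    (hIJ : I ^ h = J ^ h) : I = J := by
  classical
  by_cases hI : I = ⊥
  · subst hI
    rw [← Ideal.zero_eq_bot, zero_pow hh, eq_comm, pow_eq_zero_iff hh] at hIJ
    rw [← Ideal.zero_eq_bot, hIJ]
  by_cases hJ : J = ⊥
  · subst hJ
    rw [← Ideal.zero_eq_bot, zero_pow hh, pow_eq_zero_iff hh] at hIJ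
    exact absurd (hIJ.trans Ideal.zero_eq_bot) hI
  have hfac : UniqueFactorizationMonoid.normalizedFactors I = UniqueFactorizationMonoid.normalizedFactors J := by
    have h1 := UniqueFactorizationMonoid.normalizedFactors_pow (x := I) h
    have h2 := UniqueFactorizationMonoid.normalizedFactors_pow (x := J) h
    rw [hIJ, h2] at h1
    exact (nsmul_right_injective hh h1).symm
  have hI0 : I ≠ 0 := fun h0 => hI (h0.trans Ideal.zero_eq_bot)
  have hJ0 : J ≠ 0 := fun h0 => hJ (h0.trans Ideal.zero_eq_bot)
  have hassoc : Associated I J :=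
    (UniqueFactorizationMonoid.associated_iff_normalizedFactors_eq_normalizedFactors hI0 hJ0).2 hfac
  exact associated_iff_eq.1 hassoc

variable {K k L : Type} [Field K] [NumberField K] [Field k] [NumberField k] [Field L] [NumberField L]

omit [NumberField K] in
/-- The reflex type norm of ideals is compatible with powers (it is multiplicative, [Shimura1998] §8.3 Prop. 29).
[cite: Shimura1998, §8.3 Prop. 29] -/
theorem reflexNormIdeal_pow (Φ : Set (K →+* L)) (j : K →+* L) (σ₀ : k →+* L) (𝔞 : Ideal (𝓞 k)) (n : ℕ) :
    reflexNormIdeal Φ j σ₀ (𝔞 ^ n) = reflexNormIdeal Φ j σ₀ 𝔞 ^ n := by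
  induction n with
  | zero => simp only [pow_zero, Ideal.one_eq_top, reflexNormIdeal_top]
  | succ n ih => rw [pow_succ, pow_succ, reflexNormIdeal_mul, ih]

/-- An element of `K_vˣ` of valuation `1` is the image of a unit of `𝔬_v`. [folklore] -/
private theorem exists_units_map_subtype_eq_of_valued_eq_one (v : HeightOneSpectrum (𝓞 K))
    {u : (v.adicCompletion K)ˣ} (hu : Valued.v (u : v.adicCompletion K) = 1) :
    ∃ u₀ : (v.adicCompletionIntegers K)ˣ, Units.map ((v.adicCompletionIntegers K).subtype : _ →* _) u₀ = u :=
  HeckeCharacter.exists_units_map_subtype_eq_of_valuation_eq_one v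
    ((ValuativeRel.isEquiv (ValuativeRel.valuation (v.adicCompletion K))
      (Valued.v : Valuation (v.adicCompletion K) _)).eq_one_iff_eq_one.2 hu)

/-- **Values of a Hecke character on local ideles of valuation one are torsion** (`χ_v(𝔬_v^×)` consists of roots of unity,
`exists_pow_localComponent_unitsMap_eq_one`). [cite: TateThesis1967, §2.3] -/
theorem map_localUnits_mem_torsion (χ : HeckeCharacter K) (v : HeightOneSpectrum (𝓞 K)) {u : (v.adicCompletion K)ˣ}
    (hu : Valued.v (u : v.adicCompletion K) = 1) : χ (localUnits v u) ∈ CommGroup.torsion ℂˣ := by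
  obtain ⟨u₀, rfl⟩ := exists_units_map_subtype_eq_of_valued_eq_one v hu
  obtain ⟨N, hN, hpow⟩ := exists_pow_localComponent_unitsMap_eq_one χ v u₀
  rw [CommGroup.mem_torsion, isOfFinOrder_iff_pow_eq_one]
  exact ⟨N, Nat.pos_of_ne_zero hN, by rw [← HeckeCharacter.localComponent_apply]; exact hpow⟩

end Bookkeeping

/-! ## §2 Transfer of `reflexTypeOn` from a normal number field `L` to `ℂ` -/

section Transfer

variable {M F L : Type} [Field M] [Field F] [Field L] [NumberField L] [Normal ℚ L]
  (Θ : Set (M →+* ℂ)) (ιL : L →+* ℂ) (j : M →+* L) (σL : F →+* L)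

omit [Normal ℚ L] in
/-- An automorphism of `L` extends along `ιL` to an automorphism of `ℂ`. [folklore] -/
private theorem exists_ringAut_of_ringEquiv (s : L ≃+* L) :
    ∃ g : ℂ ≃+* ℂ, (g : ℂ →+* ℂ).comp ιL = ιL.comp s.toRingHom := by
  haveI : Countable L := Countable.of_equiv _ (Module.finBasis ℚ L).equivFun.toEquiv.symm
  obtain ⟨g, hg⟩ := Literature.AlgebraicGeometry.Motives.ZarhinLie.exists_ringEquiv_complex_comp_eq ιL
    (ιL.comp s.toRingHom)
  exact ⟨g, RingHom.ext fun a => hg a⟩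

/-- An automorphism of `ℂ` restricts along `ιL` to an automorphism of the normal field `L`. [folklore] -/
private theorem exists_ringEquiv_of_ringAut (g : ℂ ≃+* ℂ) :
    ∃ s : L ≃+* L, (g : ℂ →+* ℂ).comp ιL = ιL.comp s.toRingHom := by
  obtain ⟨ψ, hψ⟩ := exists_algHom_comp_eq_of_normal (AlgHom.id ℚ L) ιL ((g : ℂ →+* ℂ).comp ιL)
  exact ⟨(AlgEquiv.ofBijective ψ (Algebra.IsAlgebraic.algHom_bijective ψ)).toRingEquiv, hψ.symm⟩

omit [NumberField L] [Normal ℚ L] in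
/-- From `g ∘ ιL = ιL ∘ s`: `g⁻¹ ∘ ιL = ιL ∘ s⁻¹`. [folklore] -/
private theorem inv_comp_eq_comp_inv {g : ℂ ≃+* ℂ} {s : L ≃+* L} (h : (g : ℂ →+* ℂ).comp ιL = ιL.comp s.toRingHom) :
    ((g⁻¹ : ℂ ≃+* ℂ) : ℂ →+* ℂ).comp ιL = ιL.comp (s⁻¹ : L ≃+* L).toRingHom := by
  refine RingHom.ext fun b => ?_
  have h1 := RingHom.congr_fun h (s⁻¹ b)
  change g (ιL (s⁻¹ b)) = ιL (s (s⁻¹ b)) at h1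
  have hss : s (s⁻¹ b) = b := by
    change (s * s⁻¹) b = b
    rw [mul_inv_cancel]; rfl
  rw [hss] at h1
  change g⁻¹ (ιL b) = ιL (s⁻¹ b)
  rw [← h1]
  change (g⁻¹ * g) (ιL (s⁻¹ b)) = _
  rw [inv_mul_cancel]; rfl

omit [NumberField L] [Normal ℚ L] in
/-- If `g ∘ ιL = ιL ∘ s` then `ιL ∘ (s ∘ t) = g ∘ (ιL ∘ t)` for every embedding `t` into `L`. [folklore] -/
private theorem comp_smul_eq (g : ℂ ≃+* ℂ) (s : L ≃+* L) (h : (g : ℂ →+* ℂ).comp ιL = ιL.comp s.toRingHom)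
    {E : Type} [Field E] (t : E →+* L) : ιL.comp (s • t) = g • ιL.comp t := by
  refine RingHom.ext fun a => ?_
  change ιL (s (t a)) = g (ιL (t a))
  exact (RingHom.congr_fun h (t a)).symm

/-- **Transfer of the reflex type on `F` from `L` to `ℂ`**: reading the embeddings `F → L` in `ℂ` through `ιL`, the reflex type
`reflexTypeOn (valuedIn ιL Θ) j σL` of the `L`-valued type `Θ_L` becomes the reflex type `reflexTypeOn Θ (ιL ∘ j) (ιL ∘ σL)` of
`Θ ⊆ Hom(M, ℂ)` («independent of the choice of `L`», [Shimura1998] §8.3 Prop. 28: automorphisms of `ℂ` restrict to the normal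
field `L`, automorphisms of `L` extend to `ℂ`). [cite: Shimura1998, §8.3 Prop. 28] -/
theorem image_comp_reflexTypeOn_valuedIn :
    (fun σ' : F →+* L => ιL.comp σ') '' reflexTypeOn (valuedIn ιL Θ) j σL =
      reflexTypeOn Θ (ιL.comp j) (ιL.comp σL) := by
  ext φ
  rw [Set.mem_image, mem_reflexTypeOn_iff]
  constructor
  · rintro ⟨σ', hσ', rfl⟩
    obtain ⟨s, hs, rfl⟩ := (mem_reflexTypeOn_iff _ _ _ _).1 hσ'
    obtain ⟨g, hg⟩ := exists_ringAut_of_ringEquiv ιL s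
    refine ⟨g, ?_, (comp_smul_eq ιL g s hg σL).symm⟩
    rw [← comp_smul_eq ιL g⁻¹ s⁻¹ (inv_comp_eq_comp_inv ιL hg) j]
    exact hs
  · rintro ⟨g, hg, rfl⟩
    obtain ⟨s, hs⟩ := exists_ringEquiv_of_ringAut ιL g
    refine ⟨s • σL, ⟨s, ?_, rfl⟩, comp_smul_eq ιL g s hs σL⟩
    change ιL.comp (s⁻¹ • j) ∈ Θ
    rw [comp_smul_eq ιL g⁻¹ s⁻¹ (inv_comp_eq_comp_inv ιL hs) j]
    exact hg

end Transfer

/-! ## §3 The value at a uniformiser of an algebraic Hecke character, up to torsion -/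

section Value

variable {K : Type} [Field K] [NumberField K]

/-- `|ϖ_v^n|_v = exp(-n)`. [folklore] -/
private theorem valued_uniformizer_pow' (v : HeightOneSpectrum (𝓞 K)) (n : ℕ) :
    Valued.v (((HeckeCharacter.uniformizer K v : (v.adicCompletion K)ˣ) : v.adicCompletion K) ^ n) =
      WithZero.exp (-(n : ℤ)) := by
  rw [map_pow, HeckeCharacter.valued_uniformizer, ← WithZero.exp_nsmul]
  congr 1
  simp

/-- If `𝔭_v ^ h = (β)` then a place `w ≠ v` does not divide `β`: `|β|_w = 1`. [folklore] -/
private theorem valuation_eq_one_of_pow_eq_span {v w : HeightOneSpectrum (𝓞 K)} {h : ℕ} {β : 𝓞 K}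
    (hβ : v.asIdeal ^ h = Ideal.span {β}) (hwv : w ≠ v) : w.valuation K (β : K) = 1 := by
  refine le_antisymm (HeightOneSpectrum.valuation_le_one w β) (not_lt.1 fun hlt => hwv ?_)
  rw [HeightOneSpectrum.valuation_lt_one_iff_dvd, ← hβ] at hlt
  have hdvd : w.asIdeal ∣ v.asIdeal := w.prime.dvd_of_dvd_pow hlt
  have hle : v.asIdeal ≤ w.asIdeal := Ideal.le_of_dvd hdvd
  exact HeightOneSpectrum.ext (v.isMaximal.eq_of_le w.isPrime.ne_top hle).symm

/-- If `𝔭_v ^ h = (β)` (`β ≠ 0`) then `|β|_v = exp(-h)`. [folklore] -/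
private theorem valued_eq_exp_neg_of_pow_eq_span {v : HeightOneSpectrum (𝓞 K)} {h : ℕ} {β : 𝓞 K} (hβ0 : β ≠ 0)
    (hβ : v.asIdeal ^ h = Ideal.span {β}) :
    Valued.v (algebraMap K (v.adicCompletion K) (β : K)) = WithZero.exp (-(h : ℤ)) := by
  classical
  rw [HeckeCharacter.valued_coe_ringOfIntegers v hβ0, ← hβ, Associates.mk_pow,
    Associates.count_pow (Associates.mk_ne_zero.2 v.ne_bot) v.associates_irreducible,
    Associates.count_self v.associates_irreducible, mul_one]

/-- **The value at a uniformiser, up to torsion, from Neukirch's decomposition of a principal idele.**  Let `K` be totally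
complex, `χ` a Hecke character with ∞-type `typeOfExponent n` (`n : Hom(K, ℂ) → ℤ`), and `𝔭_v^h = (β)`, `β ∈ 𝔬_K ∖ {0}`.  Then
`χ(ϖ_v)^h · χ(x) = ∏_φ φ(β)^{n_φ}` for a FINITE idele `x` (a product of local ideles of valuation one) whose value `χ(x)` is a
root of unity: `1 = χ(β) = χ((β)_∞) · ∏_{w ∈ T ∪ {v}} χ(⟨β⟩_w)` (`map_principalIdele_eq`) with `⟨β⟩_w` a local unit for `w ≠ v`,
`⟨β⟩_v = ϖ_v^h · u`, and `χ((β)_∞) = ∏_φ φ(β)^{-n_φ}` (`prod_embedding_zpow_eq`). [cite: NeukirchANT1999, Ch. VII §6 Prop. (6.13) (proof)]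
[cite: Weil1956, §1] -/
theorem exists_pow_valueAtUniformizer_mul_eq_prod [IsTotallyComplex K] {χ : HeckeCharacter K} {n : (K →+* ℂ) → ℤ}
    (hχ : χ.HasInfinityType (HeckeCharacter.typeOfExponent n).1 (HeckeCharacter.typeOfExponent n).2)
    (v : HeightOneSpectrum (𝓞 K)) {h : ℕ} {β : 𝓞 K} (hβ0 : β ≠ 0) (hβ : v.asIdeal ^ h = Ideal.span {β}) :
    ∃ x : ideleGroup K, (x : AdeleRing (𝓞 K) K).1 = 1 ∧ χ x ∈ CommGroup.torsion ℂˣ ∧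
      χ.valueAtUniformizer v ^ h * ((χ x : ℂˣ) : ℂ) = ∏ φ : K →+* ℂ, φ (β : K) ^ n φ := by
  classical
  obtain ⟨T, e, hmod⟩ := χ.exists_isModulus
  have hβK : (β : K) ≠ 0 := fun h0 => hβ0 (RingOfIntegers.coe_eq_zero_iff.1 h0)
  set βu : Kˣ := Units.mk0 (β : K) hβK with hβu
  set S : Finset (HeightOneSpectrum (𝓞 K)) := insert v T with hS
  have hTS : T ⊆ S := Finset.subset_insert v T
  have hSout : ∀ w ∉ S, w.valuation K (βu : K) = 1 := fun w hw => by
    rw [hβu, Units.val_mk0]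
    exact valuation_eq_one_of_pow_eq_span hβ (fun hwv => hw (hwv ▸ Finset.mem_insert_self v T))
  -- Neukirch's decomposition of the principal idele `β`
  have hdec := HeckeCharacter.map_principalIdele_eq hmod βu hTS hSout
  rw [Finset.prod_eq_mul_prod_sdiff_singleton_of_mem (Finset.mem_insert_self v T)] at hdec
  -- the factor at `v`: `⟨β⟩_v = ϖ_v^h · u`
  set ϖ : (v.adicCompletion K)ˣ := HeckeCharacter.uniformizer K v with hϖ
  set u : (v.adicCompletion K)ˣ := globalToLocalUnits v βu * (ϖ ^ h)⁻¹ with hu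
  have hu1 : Valued.v (u : v.adicCompletion K) = 1 := by
    rw [hu, Units.val_mul, Units.val_inv_eq_inv_val, Units.val_pow_eq_pow_val, map_mul, map_inv₀,
      val_globalToLocalUnits, hβu, Units.val_mk0, valued_eq_exp_neg_of_pow_eq_span hβ0 hβ, hϖ, valued_uniformizer_pow',
      mul_inv_cancel₀ (WithZero.exp_ne_zero)]
  have hgv : globalToLocalUnits v βu = ϖ ^ h * u := by rw [hu, mul_comm (globalToLocalUnits v βu) _, mul_inv_cancel_left]
  have hvfac : χ (localUnits v (globalToLocalUnits v βu)) = χ (localUnits v ϖ) ^ h * χ (localUnits v u) := by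
    rw [hgv, map_mul, map_mul, map_pow, map_pow]
  have hϖval : ((χ (localUnits v ϖ) : ℂˣ) : ℂ) = χ.valueAtUniformizer v := by
    rw [← HeckeCharacter.localComponent_apply]; rfl
  -- the factors off `v` are values at local units
  set x₁ : ideleGroup K := ∏ w ∈ S \ {v}, localUnits w (globalToLocalUnits w βu) with hx₁
  have hx₁χ : χ x₁ = ∏ w ∈ S \ {v}, χ (localUnits w (globalToLocalUnits w βu)) := by rw [hx₁, map_prod]
  have hx₁tor : χ x₁ ∈ CommGroup.torsion ℂˣ := by
    rw [hx₁χ]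
    refine Subgroup.prod_mem _ fun w hw => map_localUnits_mem_torsion χ w ?_
    rw [val_globalToLocalUnits, Literature.NumberTheory.GaloisRepresentations.valued_algebraMap_adicCompletion w (βu : K),
      hβu, Units.val_mk0]
    have hwv : w ≠ v := fun h' => (Finset.mem_sdiff.1 hw).2 (Finset.mem_singleton.2 h')
    exact valuation_eq_one_of_pow_eq_span hβ hwv
  -- the finite idele `x = ⟨u⟩_v · x₁`
  refine ⟨localUnits v u * x₁, ?_, ?_, ?_⟩
  · rw [ideleGroup_val_fst_mul, localUnits_fst, one_mul, hx₁]
    exact fst_prod_localUnits (S \ {v}) fun w => globalToLocalUnits w βu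
  · rw [map_mul]
    exact Subgroup.mul_mem _ (map_localUnits_mem_torsion χ v hu1) hx₁tor
  -- the identity
  have harch : ((χ (infiniteIdeles K (globalToInfiniteUnits K βu)) : ℂˣ) : ℂ) = ∏ φ : K →+* ℂ, φ (β : K) ^ (-n φ) := by
    rw [hχ.apply_globalToInfiniteUnits_eq_of_isTotallyComplex βu, hβu, Units.val_mk0,
      HeckeCharacter.prod_embedding_zpow_eq _ _ hβK]
    refine Finset.prod_congr rfl fun φ _ => ?_
    rw [HeckeCharacter.embExponent_typeOfExponent]
  have hdecC : ((χ (infiniteIdeles K (globalToInfiniteUnits K βu)) : ℂˣ) : ℂ) *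
      (χ.valueAtUniformizer v ^ h * ((χ (localUnits v u * x₁) : ℂˣ) : ℂ)) = 1 := by
    have h1 : ((χ (infiniteIdeles K (globalToInfiniteUnits K βu)) *
        (χ (localUnits v (globalToLocalUnits v βu)) *
          ∏ w ∈ S \ {v}, χ (localUnits w (globalToLocalUnits w βu))) : ℂˣ) : ℂ) = 1 := by
      rw [hdec, Units.val_one]
    rw [Units.val_mul, Units.val_mul, hvfac, Units.val_mul, Units.val_pow_eq_pow_val, hϖval] at h1
    rw [map_mul, Units.val_mul, hx₁χ]
    calc _ = ((χ (infiniteIdeles K (globalToInfiniteUnits K βu)) : ℂˣ) : ℂ) *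
          (χ.valueAtUniformizer v ^ h * ((χ (localUnits v u) : ℂˣ) : ℂ) *
            ((∏ w ∈ S \ {v}, χ (localUnits w (globalToLocalUnits w βu)) : ℂˣ) : ℂ)) := by ring
      _ = 1 := h1
  have harch0 : ((χ (infiniteIdeles K (globalToInfiniteUnits K βu)) : ℂˣ) : ℂ) ≠ 0 := Units.ne_zero _
  have hval : χ.valueAtUniformizer v ^ h * ((χ (localUnits v u * x₁) : ℂˣ) : ℂ) =
      (((χ (infiniteIdeles K (globalToInfiniteUnits K βu)) : ℂˣ) : ℂ))⁻¹ :=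
    eq_inv_of_mul_eq_one_right hdecC
  rw [hval, harch, ← Finset.prod_inv_distrib]
  refine Finset.prod_congr rfl fun φ _ => ?_
  rw [zpow_neg, inv_inv]

end Value

/-! ## §4 The uniformiser clause of (19.10b) for `μ^{alg}`, and Prop. 4.6 (1) without displayed `μ`-hypotheses -/

section Main

variable {F : Type} [Field F] [NumberField F] [IsCMField F] [IsGalois ℚ F] (σ : F →+* ℂ)
  {μ : IdeleClassGroup F →ₜ* Circle} (hμ : IdeleClassGroup.IsConjugateSymplectic F μ)
  (hw : IdeleClassGroup.HasWeight F μ 1)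

omit [IsCMField F] [IsGalois ℚ F] in
/-- Every nonzero ideal of a number field has a principal power: `𝔭^h = (β)` with `h ≥ 1`, `β ≠ 0` (finiteness of the class
group). [folklore] -/
private theorem exists_pow_eq_span (v : HeightOneSpectrum (𝓞 F)) :
    ∃ h : ℕ, h ≠ 0 ∧ ∃ β : 𝓞 F, β ≠ 0 ∧ v.asIdeal ^ h = Ideal.span {β} := by
  classical
  set h := Fintype.card (ClassGroup (𝓞 F)) with hh
  have hI : v.asIdeal ∈ (Ideal (𝓞 F))⁰ := mem_nonZeroDivisors_of_ne_zero (by simpa using v.ne_bot)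
  have hIh : v.asIdeal ^ h ∈ (Ideal (𝓞 F))⁰ := pow_mem hI h
  have h1 : ClassGroup.mk0 ⟨v.asIdeal ^ h, hIh⟩ = 1 := by
    have : (⟨v.asIdeal ^ h, hIh⟩ : (Ideal (𝓞 F))⁰) = ⟨v.asIdeal, hI⟩ ^ h := Subtype.ext rfl
    rw [this, map_pow, pow_card_eq_one]
  have hprinc : (v.asIdeal ^ h).IsPrincipal := (ClassGroup.mk0_eq_one_iff hIh).1 h1
  refine ⟨h, Fintype.card_ne_zero, Submodule.IsPrincipal.generator (v.asIdeal ^ h), ?_, ?_⟩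
  · intro h0
    have := Ideal.span_singleton_generator (v.asIdeal ^ h)
    rw [h0, Ideal.span_singleton_eq_bot.2 rfl] at this
    exact pow_ne_zero h v.ne_bot (this.symm.trans Ideal.zero_eq_bot.symm |>.trans rfl)
  · exact (Ideal.span_singleton_generator (v.asIdeal ^ h)).symm

include hw in
/-- The ∞-type of `μ^{alg}` as the type attached to the indicator of `Φ_μ` (weight one; `hasInfinityType_muAlg_cmInfinityType`
read through the duality `cmInfinityType_inducedCMType_reflexCMType`). [cite: Liu2021, Def. 4.3 and the display after it (TeX ll. 1915–1926)] -/
theorem hasInfinityType_muAlg_typeOfExponent :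
    (IdeleClassGroup.muAlg F μ).HasInfinityType
      (HeckeCharacter.typeOfExponent (hμ.cmType.1.indicator fun _ => (1 : ℤ))).1
      (HeckeCharacter.typeOfExponent (hμ.cmType.1.indicator fun _ => (1 : ℤ))).2 := by
  obtain ⟨σ'⟩ : Nonempty (F →+* ℂ) := inferInstance
  have hσ : σ'.comp ((AlgHom.id ℚ F : F →ₐ[ℚ] F) : F →+* F) = σ' := RingHom.ext fun _ => rfl
  have hcm := cmInfinityType_inducedCMType_reflexCMType hμ.cmType (AlgHom.id ℚ F) σ' (incl (AlgHom.id ℚ F) σ' hμ)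
    (IdeleClassGroup.muAlgValueField F μ).subtype (coe_incl (AlgHom.id ℚ F) σ' hμ)
  rw [hσ] at hcm
  rw [← hcm]
  exact hasInfinityType_muAlg_cmInfinityType σ' hμ hw

omit [IsCMField F] [IsGalois ℚ F] in
/-- `∏_φ φ(β)^{𝟙_Φ(φ)} = ∏_{φ ∈ Φ} φ(β)` (bookkeeping). [folklore] -/
private theorem prod_zpow_indicator_eq (Φ : Set (F →+* ℂ)) (b : F) :
    ∏ φ : F →+* ℂ, φ b ^ (Φ.indicator (fun _ => (1 : ℤ)) φ) = ∏ φ ∈ (Set.toFinite Φ).toFinset, φ b := by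
  classical
  rw [← Finset.prod_filter_mul_prod_filter_not Finset.univ (· ∈ Φ)]
  have h2 : ∏ φ ∈ Finset.univ.filter (fun φ : F →+* ℂ => ¬ φ ∈ Φ), φ b ^ (Φ.indicator (fun _ => (1 : ℤ)) φ) = 1 :=
    Finset.prod_eq_one fun φ hφ => by
      rw [Set.indicator_of_notMem (Finset.mem_filter.1 hφ).2, zpow_zero]
  rw [h2, mul_one]
  have hs : Finset.univ.filter (fun φ : F →+* ℂ => φ ∈ Φ) = (Set.toFinite Φ).toFinset := by
    ext φ; simp
  rw [hs]
  refine Finset.prod_congr rfl fun φ hφ => ?_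
  rw [Set.indicator_of_mem ((Set.Finite.mem_toFinset _).1 hφ), zpow_one]

include hw in
/-- **The uniformiser clause of [Shimura1998] (19.10b) for `χ = μ^{alg}` at `(K, Φ) = (M_μ, Ψ̃_μ)`, `k = F`** — the
SHIMURA–TANIYAMA FACTORISATION of the values of `μ^{alg}`: at every finite place `v` of `F` there is `π_v ∈ 𝔬_{M_μ}` with
`μ^{alg}(ϖ_v) = π_v` and `(π_v) = g(N_{F/K*} 𝔭_v)` — `j(π_v)𝔬_L = ∏_{σ' ∈ Ψ_j} σ'(𝔭_v)𝔬_L` in every number field `L` normal over `ℚ`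
through which `F ⊆ ℂ` factors (`IsReflexTypeNorm`).  Proof: `𝔭_v^h = (β)`; `μ^{alg}(ϖ_v)^h · ζ = ∏_{φ ∈ Φ_μ} φ(β)` with `ζ` a root of
unity of `M_μ` (`exists_pow_valueAtUniformizer_mul_eq_prod`); the right side is `j`-conjugate to `∏_{σ' ∈ Ψ_j} σ'(β)` (transfer +
duality `reflexTypeOn Ψ̃_μ = Φ_μ`), whose ideal is the reflex type norm of `(β) = 𝔭_v^h`; extract the `h`-th root.
[cite: Shimura1998, Prop. 19.10 (19.10b) and §8.3 Prop. 29] [cite: Weil1956, §1] -/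
theorem exists_integer_valueAtUniformizer_isReflexTypeNorm (v : HeightOneSpectrum (𝓞 F)) :
    ∃ π : 𝓞 (IdeleClassGroup.muAlgValueField F μ),
      (IdeleClassGroup.muAlg F μ).valueAtUniformizer v =
          (IdeleClassGroup.muAlgValueField F μ).subtype (π : IdeleClassGroup.muAlgValueField F μ) ∧
        ∀ (L : Type) [Field L] [NumberField L] [Normal ℚ L] (ιL : L →+* ℂ)
          (j : IdeleClassGroup.muAlgValueField F μ →+* L) (σL : F →+* L), ιL.comp σL = σ →
          IsReflexTypeNorm
            (valuedIn ιL (inducedCMType (incl (AlgHom.id ℚ F) σ hμ) (reflexCMType σ hμ.cmType (AlgHom.id ℚ F))).1)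
            j σL v.asIdeal (Ideal.span {π}) := by
  classical
  haveI := hμ.numberField_muAlgValueField
  set M := IdeleClassGroup.muAlgValueField F μ with hM
  set χ := IdeleClassGroup.muAlg F μ with hχ
  set Φ := hμ.cmType with hΦ
  set Ψ := inducedCMType (incl (AlgHom.id ℚ F) σ hμ) (reflexCMType σ hμ.cmType (AlgHom.id ℚ F)) with hΨ
  -- `𝔭_v^h = (β)` and the value identity `χ(ϖ_v)^h · χ(x) = ∏_{φ ∈ Φ} φ(β)`
  obtain ⟨h, hh, β, hβ0, hβ⟩ := exists_pow_eq_span v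
  obtain ⟨x, hx1, hxtor, hval⟩ :=
    exists_pow_valueAtUniformizer_mul_eq_prod (hasInfinityType_muAlg_typeOfExponent hμ hw) v hβ0 hβ
  rw [prod_zpow_indicator_eq] at hval
  -- everything lies in `M = M_μ`
  set π₀ : ℂ := χ.valueAtUniformizer v with hπ₀
  have hπ₀M : π₀ ∈ M := IdeleClassGroup.valueAtUniformizer_muAlg_mem_muAlgValueField F μ v
  set z : ℂ := ((χ x : ℂˣ) : ℂ) with hz
  have hzM : z ∈ M := IdeleClassGroup.coe_muAlg_mem_muAlgValueField F μ hx1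
  obtain ⟨N, hN, hzN⟩ := isOfFinOrder_iff_pow_eq_one.1 ((CommGroup.mem_torsion (χ x)).1 hxtor)
  have hzN' : z ^ N = 1 := by rw [hz, ← Units.val_pow_eq_pow_val, hzN, Units.val_one]
  set πM : M := ⟨π₀, hπ₀M⟩ with hπM
  set zM : M := ⟨z, hzM⟩ with hzMdef
  have hzMN : zM ^ N = 1 := Subtype.ext (by rw [SubmonoidClass.coe_pow]; exact hzN')
  have hzMint : IsIntegral ℤ zM := IsIntegral.of_pow hN (by rw [hzMN]; exact isIntegral_one)
  set zO : 𝓞 M := ⟨zM, (mem_integralClosure_iff ℤ _).2 hzMint⟩ with hzO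
  have hzON : zO ^ N = 1 := by
    apply RingOfIntegers.ext
    rw [RingOfIntegers.coe_eq_algebraMap, RingOfIntegers.coe_eq_algebraMap, map_pow, map_one]
    exact hzMN
  have hzOunit : IsUnit zO := (Units.ofPowEqOne zO N hzON hN.ne').isUnit
  -- `N_β := π₀^h · z ∈ M` is an algebraic integer: it is `∏_{φ ∈ Φ} φ(β)`
  set NM : M := πM ^ h * zM with hNM
  have hNMval : ((NM : M) : ℂ) = ∏ φ ∈ (Set.toFinite Φ.1).toFinset, φ (β : F) := by
    rw [hNM, Subfield.coe_mul, SubmonoidClass.coe_pow]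
    exact hval
  have hNint : IsIntegral ℤ NM := by
    have hC : IsIntegral ℤ ((NM : M) : ℂ) := by
      rw [hNMval]
      exact IsIntegral.prod _ fun φ _ => (RingOfIntegers.isIntegral_coe β).map φ.toIntAlgHom
    exact (isIntegral_algHom_iff M.subtype.toIntAlgHom Subtype.val_injective).1 hC
  -- `π₀` is an algebraic integer: `π₀^h = N_β · z^{N-1}`
  have hπMh : πM ^ h = NM * zM ^ (N - 1) := by
    rw [hNM, mul_assoc, ← pow_succ', Nat.sub_add_cancel hN, hzMN, mul_one]
  have hπMint : IsIntegral ℤ πM :=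
    IsIntegral.of_pow (Nat.pos_of_ne_zero hh) (by rw [hπMh]; exact hNint.mul (hzMint.pow _))
  set πO : 𝓞 M := ⟨πM, (mem_integralClosure_iff ℤ _).2 hπMint⟩ with hπO
  set NO : 𝓞 M := πO ^ h * zO with hNO
  have hNOval : ((NO : M) : ℂ) = ∏ φ ∈ (Set.toFinite Φ.1).toFinset, φ (β : F) := by
    rw [← hNMval]; rfl
  refine ⟨πO, rfl, fun L _ _ _ ιL j σL hc => ?_⟩
  -- transfer + duality: `ιL ∘ Ψ_j = g • Φ` for `g ∈ Aut ℂ` with `g|_M = ιL ∘ j`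
  haveI : Countable M := Countable.of_equiv _ (Module.finBasis ℚ M).equivFun.toEquiv.symm
  obtain ⟨g, hg⟩ := Literature.AlgebraicGeometry.Motives.ZarhinLie.exists_ringEquiv_complex_comp_eq M.subtype (ιL.comp j)
  have hgj : ιL.comp j = g • M.subtype := RingHom.ext fun m => (hg m).symm
  have hσ : σ.comp ((AlgHom.id ℚ F : F →ₐ[ℚ] F) : F →+* F) = σ := RingHom.ext fun _ => rfl
  have hR := reflexTypeOn_inducedCMType_reflexCMType hμ.cmType (AlgHom.id ℚ F) σ (incl (AlgHom.id ℚ F) σ hμ)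
    M.subtype (coe_incl (AlgHom.id ℚ F) σ hμ)
  rw [hσ] at hR
  have himg : (fun σ' : F →+* L => ιL.comp σ') '' reflexTypeOn (valuedIn ιL Ψ.1) j σL = g • Φ.1 := by
    rw [image_comp_reflexTypeOn_valuedIn, hc, hgj, reflexTypeOn_smul_left, hΨ, hR]
  -- the element identity `j(N_β) = ∏_{σ' ∈ Ψ_j} σ'(β)` in `L`
  have helt : j (NO : M) = ∏ σ' ∈ (finite_reflexTypeOn (valuedIn ιL Ψ.1) j σL).toFinset, σ' (β : F) := by
    apply ιL.injective
    rw [map_prod]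
    have h1 : ιL (j (NO : M)) = g ((NO : M) : ℂ) := (hg (NO : M)).symm
    rw [h1, hNOval, map_prod]
    symm
    refine Finset.prod_bij (fun σ' _ => g⁻¹ • ιL.comp σ') (fun σ' hσ' => ?_) (fun σ₁ h₁ σ₂ h₂ heq => ?_)
      (fun φ hφ => ?_) (fun σ' hσ' => ?_)
    · rw [Set.Finite.mem_toFinset] at hσ' ⊢
      have hmem : ιL.comp σ' ∈ g • Φ.1 := himg ▸ Set.mem_image_of_mem _ hσ'
      rwa [Set.mem_smul_set_iff_inv_smul_mem] at hmem
    · have heq' : ιL.comp σ₁ = ιL.comp σ₂ := smul_left_cancel g⁻¹ heq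
      exact RingHom.ext fun a => ιL.injective (RingHom.congr_fun heq' a)
    · rw [Set.Finite.mem_toFinset] at hφ
      have hmem : g • φ ∈ (fun σ' : F →+* L => ιL.comp σ') '' reflexTypeOn (valuedIn ιL Ψ.1) j σL := by
        rw [himg]; exact Set.smul_mem_smul_set hφ
      obtain ⟨σ', hσ', hσ'φ⟩ := hmem
      exact ⟨σ', (Set.Finite.mem_toFinset _).2 hσ', by simp only [hσ'φ, inv_smul_smul]⟩
    · change ιL (σ' (β : F)) = g ((g⁻¹ • ιL.comp σ') (β : F))
      change ιL (σ' (β : F)) = g (g⁻¹ (ιL (σ' (β : F))))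
      change _ = (g * g⁻¹) _
      rw [mul_inv_cancel]; rfl
  -- ideals: `(j N_β) = reflexNormIdeal (β) = reflexNormIdeal(𝔭_v)^h` and `(N_β) = (π)^h`
  have hN : IsReflexTypeNorm (valuedIn ιL Ψ.1) j σL (Ideal.span {β}) (Ideal.span {NO}) :=
    isReflexTypeNorm_span_singleton helt
  have hspan : Ideal.span {NO} = Ideal.span {πO} ^ h := by
    rw [hNO, Ideal.span_singleton_mul_right_unit hzOunit, Ideal.span_singleton_pow]
  rw [IsReflexTypeNorm, hspan, ← hβ, reflexNormIdeal_pow, Ideal.map_pow] at hN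
  exact ideal_eq_of_pow_eq_pow hh hN

include hw in
/-- **[Liu2021, Prop. 4.6 (1)], first clause «`𝒜(μ)` is nonempty», from Casselman's theorem — no displayed hypothesis on
`μ` left.**  For a CM field `F` Galois over `ℚ`, a pin `σ : F → ℂ` and `μ` conjugate symplectic of weight one: GIVEN Casselman's
theorem `h21` ([Shimura1998] Thm. 21.4, the tree's named fact `shimura1998_thm21_4_casselman`) and an inhabitant of the posited
⟨CARRIER⟩ `P` of the last two bullets `(λ_μ, r_μ)` of Def. 4.5 (2), there is a CM datum for `μ` in the as-printed sense
`Def45.CMDatum (AlgHom.id ℚ F) σ hμ hw (Carriers.ofPolDR μ P)` — [Liu2021] ll. 1975–1984 in the one-step variant (Thm. 21.4 at the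
induced type `(M_μ, Ψ̃_μ)` over `k = F`), all of (19.10a, b) for `χ = μ^{alg}` being PROVED (`Prop46NonemptyOfCasselman`,
`…Units`, and `exists_integer_valueAtUniformizer_isReflexTypeNorm`). [cite: Liu2021, Prop. 4.6 (1) (TeX l. 1969) and its proof (ll. 1975–1984)]
[cite: Shimura1998, §21.4 Thm. 21.4 and Prop. 19.10 (19.10a, b)] [cite: Shimura1971ZetaCM, Theorem 6] -/
theorem nonempty_cmDatum_of_casselman' (h21 : shimura1998_thm21_4_casselman)
    (P : ∀ A : AbelianVariety F, (IdeleClassGroup.muAlgValueField F μ →+* A.endAlgebra) → Type)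
    (hP : ∀ A i, Nonempty (P A i)) :
    Nonempty (CMDatum (AlgHom.id ℚ F) σ hμ hw (Carriers.ofPolDR μ P)) :=
  nonempty_cmDatum_of_casselman_of_uniformizers σ hμ hw h21
    (fun v => exists_integer_valueAtUniformizer_isReflexTypeNorm σ hμ hw v) P hP

end Main

end Literature.NumberTheory.Automorphic.Liu2021.Def45

end
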